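import Mathlib

/-!
# Sketch — val-idea-23 (d): the MONOTONE CYCLE LAW for linear parametric assignment
(first lemma of crux idea `cycle-monotone-codes` on `LacunarySymmetroid.MatrixDescartes`, refute side via the
tropical door `MatrixDescartes_false_of_TropicalMonster`).  Self-contained over Mathlib; nothing asserted.
-/

open Finset BigOperators

namespace Summit.ValiantsHypothesis.ValiantsHypothesis.Cruxes.MatrixDescartes.CycleMonotone

/-- slope of a permutation under a cell-slope table `D` (for a `K`-class design, `D i j = d (cls i j)`). -/
def slope {N : ℕ} (D : Fin N → Fin N → ℝ) (σ : Equiv.Perm (Fin N)) : ℝ := ∑ i, D i (σ i)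

/-- cost of a permutation under a cell-cost table `A`. -/
def cost {N : ℕ} (A : Fin N → Fin N → ℝ) (σ : Equiv.Perm (Fin N)) : ℝ := ∑ i, A i (σ i)

/-- `σ` maximises `cost + θ·slope` over all permutations (an optimum of the parametric assignment at `θ`). -/
def IsOptAt {N : ℕ} (A D : Fin N → Fin N → ℝ) (θ : ℝ) (σ : Equiv.Perm (Fin N)) : Prop :=
  ∀ τ : Equiv.Perm (Fin N), cost A τ + θ * slope D τ ≤ cost A σ + θ * slope D σ

/-- **MONOTONE CYCLE LAW (MCL).**  If `σ₁` is optimal at `θ₁` and `σ₂` at `θ₂ > θ₁`, then on every common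
invariant row set `U` (`σ₁ '' U = σ₂ '' U` as column sets — e.g. the row set of any union of alternating cycles of
`σ₁ Δ σ₂`) the slope carried by `σ₂` is at least the slope carried by `σ₁`.  Scale-free, pairwise (not only
consecutive optima), arbitrary real cell slopes.  Proof (4 lines): the two `U`-switched permutations `σ₃ = σ₂|U ∪ σ₁|Uᶜ`,
`σ₄ = σ₁|U ∪ σ₂|Uᶜ` satisfy `f_θ(σ₃)+f_θ(σ₄) = f_θ(σ₁)+f_θ(σ₂)` for every `θ`; optimality of `σ₁` at `θ₁` and of `σ₂`
at `θ₂` give `f_{θ₂}(σ₃) ≥ f_{θ₂}(σ₁)` and `f_{θ₁}(σ₃) ≤ f_{θ₁}(σ₁)`, whence `(θ₂−θ₁)(slope σ₃ − slope σ₁) ≥ 0`. -/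
def MonotoneCycleLaw : Prop :=
  ∀ (N : ℕ) (A D : Fin N → Fin N → ℝ) (θ₁ θ₂ : ℝ), θ₁ < θ₂ →
    ∀ (σ₁ σ₂ : Equiv.Perm (Fin N)), IsOptAt A D θ₁ σ₁ → IsOptAt A D θ₂ σ₂ →
      ∀ U : Finset (Fin N), U.image σ₁ = U.image σ₂ →
        ∑ i ∈ U, D i (σ₁ i) ≤ ∑ i ∈ U, D i (σ₂ i)

/-- The switched permutation used in the proof: `σ₂` on `U`, `σ₁` off `U` (a permutation because the images agree). -/
theorem exists_switch {N : ℕ} (σ₁ σ₂ : Equiv.Perm (Fin N)) (U : Finset (Fin N))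
    (hU : U.image σ₁ = U.image σ₂) :
    ∃ σ₃ : Equiv.Perm (Fin N), (∀ i ∈ U, σ₃ i = σ₂ i) ∧ (∀ i ∉ U, σ₃ i = σ₁ i) := by
  classical
  let g : Fin N → Fin N := fun i => if i ∈ U then σ₂ i else σ₁ i
  have ginj : Function.Injective g := by
    intro i j hij
    change (if i ∈ U then σ₂ i else σ₁ i) = (if j ∈ U then σ₂ j else σ₁ j) at hij
    by_cases hi : i ∈ U <;> by_cases hj : j ∈ U
    · rw [if_pos hi, if_pos hj] at hij; exact σ₂.injective hij
    · rw [if_pos hi, if_neg hj] at hij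
      exfalso
      have hmem : σ₂ i ∈ U.image σ₂ := Finset.mem_image_of_mem _ hi
      rw [← hU, hij] at hmem
      obtain ⟨k, hk, hkj⟩ := Finset.mem_image.mp hmem
      exact hj (σ₁.injective hkj ▸ hk)
    · rw [if_neg hi, if_pos hj] at hij
      exfalso
      have hmem : σ₂ j ∈ U.image σ₂ := Finset.mem_image_of_mem _ hj
      rw [← hU, ← hij] at hmem
      obtain ⟨k, hk, hki⟩ := Finset.mem_image.mp hmem
      exact hi (σ₁.injective hki ▸ hk)
    · rw [if_neg hi, if_neg hj] at hij; exact σ₁.injective hij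
  refine ⟨Equiv.ofBijective g (Finite.injective_iff_bijective.mp ginj), ?_, ?_⟩
  · intro i hi; simp [g, hi]
  · intro i hi; simp [g, hi]

/-- **MCL holds** (proved here, Mathlib only). -/
theorem monotoneCycleLaw_holds : MonotoneCycleLaw := by
  intro N A D θ₁ θ₂ hθ σ₁ σ₂ h₁ h₂ U hU
  obtain ⟨σ₃, h3U, h3c⟩ := exists_switch σ₁ σ₂ U hU
  obtain ⟨σ₄, h4U, h4c⟩ := exists_switch σ₂ σ₁ U hU.symm
  have key : ∀ F : Fin N → Fin N → ℝ,
      ∑ i, F i (σ₃ i) + ∑ i, F i (σ₄ i) = ∑ i, F i (σ₁ i) + ∑ i, F i (σ₂ i) := by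
    intro F
    rw [← Finset.sum_add_distrib, ← Finset.sum_add_distrib]
    apply Finset.sum_congr rfl
    intro i _
    by_cases hi : i ∈ U
    · rw [h3U i hi, h4U i hi, add_comm]
    · rw [h3c i hi, h4c i hi]
  have kc : cost A σ₃ + cost A σ₄ = cost A σ₁ + cost A σ₂ := key A
  have ks : slope D σ₃ + slope D σ₄ = slope D σ₁ + slope D σ₂ := key D
  have hvan : ∀ x ∈ (Finset.univ : Finset (Fin N)), x ∉ U → (D x (σ₃ x) - D x (σ₁ x)) = 0 := by
    intro x _ hx; rw [h3c x hx]; exact sub_self _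
  have hs3 : slope D σ₃ - slope D σ₁ = ∑ i ∈ U, (D i (σ₂ i) - D i (σ₁ i)) := by
    unfold slope
    rw [← Finset.sum_sub_distrib, ← Finset.sum_subset (Finset.subset_univ U) hvan]
    exact Finset.sum_congr rfl (fun i hi => by rw [h3U i hi])
  rw [Finset.sum_sub_distrib] at hs3
  have e1 := h₁ σ₃
  have e2 := h₂ σ₄
  have ks2 : θ₂ * slope D σ₃ + θ₂ * slope D σ₄ = θ₂ * slope D σ₁ + θ₂ * slope D σ₂ := by
    rw [← mul_add, ← mul_add, ks]
  have e3 : cost A σ₁ + θ₂ * slope D σ₁ ≤ cost A σ₃ + θ₂ * slope D σ₃ := by linarith [e2, kc, ks2]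
  have hpos : 0 < θ₂ - θ₁ := sub_pos.mpr hθ
  have e5 : 0 ≤ slope D σ₃ - slope D σ₁ := by
    by_contra hneg
    push_neg at hneg
    have hprod := mul_neg_of_pos_of_neg hpos hneg
    nlinarith [e1, e3, hprod]
  linarith [e5, hs3]

/-- statement-level sanity: MCL is the conjunction over all data of the displayed inequality. -/
theorem monotoneCycleLaw_stmt : MonotoneCycleLaw ↔
    ∀ (N : ℕ) (A D : Fin N → Fin N → ℝ) (θ₁ θ₂ : ℝ), θ₁ < θ₂ →
    ∀ (σ₁ σ₂ : Equiv.Perm (Fin N)), IsOptAt A D θ₁ σ₁ → IsOptAt A D θ₂ σ₂ →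
      ∀ U : Finset (Fin N), U.image σ₁ = U.image σ₂ →
        ∑ i ∈ U, D i (σ₁ i) ≤ ∑ i ∈ U, D i (σ₂ i) := Iff.rfl

/-- **Cycle-monotone code** (the combinatorial shadow of an upper-hull family): a family of permutations indexed by
increasing parameter, pairwise satisfying the MCL inequality on every common invariant set, with pairwise distinct
slopes.  `TropicalMonster`-type families are realisable cycle-monotone codes; the code condition is necessary. -/
def IsCycleMonotoneCode {N n : ℕ} (D : Fin N → Fin N → ℝ) (σ : Fin n → Equiv.Perm (Fin N)) : Prop :=
  (∀ j k : Fin n, j < k → slope D (σ j) < slope D (σ k)) ∧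
  ∀ j k : Fin n, j < k → ∀ U : Finset (Fin N), U.image (σ j) = U.image (σ k) →
    ∑ i ∈ U, D i (σ j i) ≤ ∑ i ∈ U, D i (σ k i)

/-- Necessity (PROVED): the optima of any increasing parameter sequence form a cycle-monotone
code once their slopes are distinct. -/
theorem isCycleMonotoneCode_of_opt {N n : ℕ} (A D : Fin N → Fin N → ℝ)
    (θ : Fin n → ℝ) (hθ : StrictMono θ) (σ : Fin n → Equiv.Perm (Fin N))
    (hopt : ∀ k, IsOptAt A D (θ k) (σ k)) (hslope : ∀ j k : Fin n, j < k → slope D (σ j) < slope D (σ k)) :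
    IsCycleMonotoneCode D σ := by
  refine ⟨hslope, ?_⟩
  intro j k hjk U hU
  exact monotoneCycleLaw_holds N A D (θ j) (θ k) (hθ hjk) (σ j) (σ k) (hopt j) (hopt k) U hU

end Summit.ValiantsHypothesis.ValiantsHypothesis.Cruxes.MatrixDescartes.CycleMonotone
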